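import Literature.Computability.Cryptography.LWEHardness
import Literature.Computability.Complexity.ListBricks
import HarnessLib

/-!
# The bit-string code of a tuple of LWE samples, field by field

Topic `Computability/Cryptography` (LWE), grouping namespace `LWE`. The oracle of
`regev_decision_to_search` (`LWEHardness.lean`) is queried on the self-describing code
`encodeLWESamples S` of a tuple `S` of `m` samples `(a_p, b_p) ∈ ℤ_qⁿ × ℤ_q`:

  `⟨bin n, ⟨bin q, ⟨1ᵐ, ⟪item₀, …, item_{m-1}⟫⟩⟩⟩`,  `item_p = ⟨⟨1ⁿ, ⟪bin (a_p)₀, …, bin (a_p)_{n-1}⟫⟩, bin b_p⟩`,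

where `⟨·, ·⟩` is `boolPair`, `⟪…⟫` the nested-pair list code `encList` of `StackLists.lean`
(= the body of `Encoding.listBool`) and `bin` Mathlib's `encodeNat` of the representative
`ZMod.val ∈ [0, q)`. This file records that description (`encodeLWESamples_eq` with
`lweResidueCode`, `lweSampleCode`, `lweBlockCode`), the projections of the pieces under the record
accessors `fstF`/`sndF` of `BrickAlgebra.lean`, and polynomial length bounds — the interface through
which the polynomial-time machine of the decision-to-search reduction (which is written in the
tree's algebra of `FP` string functions on such records) reads and writes LWE samples.

**Twins (recorded per the tree's convention).** The search-to-decision machine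
`Cryptography/LWESearchToDecisionMachine.lean` (landed concurrently; it imports `LWEHardness` too but
is NOT in this file's import closure — importing it would add some 40 files) holds the same
description under `S2D.sampleCode` (= `lweSampleCode` with `unaryEncodeNat n` for `ones n`, the residue
code inlined; `S2D.sampleCode x = lweSampleCode x` by `unaryEncodeNat_eq_replicate`),
`S2D.encodeLWESamples_eq` and `S2D.foldr_boolPair_eq_encList` (byte-identical to
`foldr_boolPair_eq_encList` here); the generic `listBool_encode_eq_encList` /
`encodingFinVec_encode_eq` are twins of `Complexity/ListFoldChecks.lean` (`listBool` body as
`encList`) and `Complexity/EncodingFrames.lean` (`finVec_encode_eq`, frames form), neither in the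
closure. The intended shared survivors are this file's `lweResidueCode`/`lweSampleCode`/
`lweBlockCode`/`encodeLWESamples_eq` (a small file on top of `LWEHardness` + `ListBricks` that both
machines can import; the `S2D` file can be repointed here); a bridge lemma
`S2D.sampleCode = lweSampleCode` belongs in whichever file first imports both.

## References

* O. Regev, *On lattices, learning with errors, random linear codes, and cryptography*, J. ACM 56
  (2009), §2 (the input of an LWE algorithm: a list of samples from `ℤ_pⁿ × ℤ_p`).
  [cite: RegevLWE2009, §2]
* S. Arora, B. Barak, *Computational Complexity: A Modern Approach*, CUP 2009, §0.1
  (representing tuples and lists as strings) — background for the pairing conventions only.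
-/

noncomputable section

namespace Literature.Computability.Cryptography

namespace LWE

open _root_.Computability Complexity Complexity.Brick

variable {n q m : ℕ}

/-! ### The codes -/

/-- The code of a residue vector `a ∈ ℤ_qⁿ`: the list code of the binary numerals of the
representatives, `⟪bin a₀, …, bin a_{n-1}⟫` (inlined in the twin `S2D.sampleCode`). [cite: RegevLWE2009, §2] -/
def lweResidueCode (a : Fin n → ZMod q) : List Bool :=
  encList (List.ofFn fun i => encodeNat (a i).val)

/-- The code of one sample `(a, b)`: `⟨⟨1ⁿ, code of a⟩, bin b⟩`. Twin (intended survivor: this one):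
`S2D.sampleCode` of `LWESearchToDecisionMachine.lean`, equal to it by `unaryEncodeNat_eq_replicate`.
[cite: RegevLWE2009, §2] -/
def lweSampleCode (x : (Fin n → ZMod q) × ZMod q) : List Bool :=
  boolPair (boolPair (ones n) (lweResidueCode x.1)) (encodeNat x.2.val)

/-- The code of the list of samples of a block: `⟪item₀, …, item_{m-1}⟫`. [cite: RegevLWE2009, §2] -/
def lweBlockCode (blk : Fin m → (Fin n → ZMod q) × ZMod q) : List Bool :=
  encList (List.ofFn fun p => lweSampleCode (blk p))

/-- The list underlying `lweResidueCode`. [folklore] -/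
def residueList (a : Fin n → ZMod q) : List (List Bool) := List.ofFn fun i => encodeNat (a i).val

/-- The list underlying `lweBlockCode`. [folklore] -/
def sampleList (blk : Fin m → (Fin n → ZMod q) × ZMod q) : List (List Bool) := List.ofFn fun p => lweSampleCode (blk p)

/-- `lweResidueCode a = encList (residueList a)`. [folklore] -/
theorem lweResidueCode_eq (a : Fin n → ZMod q) : lweResidueCode a = encList (residueList a) := rfl

/-- `lweBlockCode blk = encList (sampleList blk)`. [folklore] -/
theorem lweBlockCode_eq (blk : Fin m → (Fin n → ZMod q) × ZMod q) : lweBlockCode blk = encList (sampleList blk) := rfl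

/-- `residueList` has `n` entries. [folklore] -/
@[simp] theorem length_residueList (a : Fin n → ZMod q) : (residueList a).length = n := List.length_ofFn

/-- `sampleList` has `m` entries. [folklore] -/
@[simp] theorem length_sampleList (blk : Fin m → (Fin n → ZMod q) × ZMod q) : (sampleList blk).length = m :=
  List.length_ofFn

/-- The entries of `residueList`. [folklore] -/
theorem getElem_residueList (a : Fin n → ZMod q) {i : ℕ} (hi : i < (residueList a).length) :
    (residueList a)[i] = encodeNat (a ⟨i, by simpa using hi⟩).val := by
  simp [residueList]

/-- The entries of `sampleList`. [folklore] -/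
theorem getElem_sampleList (blk : Fin m → (Fin n → ZMod q) × ZMod q) {p : ℕ} (hp : p < (sampleList blk).length) :
    (sampleList blk)[p] = lweSampleCode (blk ⟨p, by simpa using hp⟩) := by
  simp [sampleList]

/-- The entries of `sampleList`, `getD` form (the form produced by `nthLF`). [folklore] -/
theorem getD_sampleList (blk : Fin m → (Fin n → ZMod q) × ZMod q) (p : Fin m) :
    (sampleList blk).getD p.val [] = lweSampleCode (blk p) := by
  rw [List.getD_eq_getElem _ _ (by simp), getElem_sampleList]

/-! ### `encodeLWESamples` field by field -/

/-- The body of a `listBool` code is the nested-pair list code of the item codes. Twins: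
`S2D.foldr_boolPair_eq_encList` (`LWESearchToDecisionMachine.lean`, byte-identical) and the `listBool`
lemma of `Complexity/ListFoldChecks.lean`; neither is in this file's import closure. [folklore] -/
theorem foldr_boolPair_eq_encList {α : Type} (e : α → List Bool) (l : List α) :
    l.foldr (fun a acc => boolPair (e a) acc) [] = encList (l.map e) := by
  induction l with
  | nil => rfl
  | cons a l ih => rw [List.foldr_cons, ih, List.map_cons, encList_cons]

/-- `Encoding.listBool` spelled out: `⟨1^{|l|}, ⟪e a₁, …⟫⟩` (twin of the `ListFoldChecks.lean` form). [folklore] -/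
theorem listBool_encode_eq_encList {α : Type} (e : Encoding α Bool) (l : List α) :
    e.listBool.encode l = boolPair (ones l.length) (encList (l.map e.encode)) := by
  show boolPair (unaryEncodeNat l.length) (l.foldr (fun a acc => boolPair (e.encode a) acc) []) = _
  rw [unaryEncodeNat_eq_replicate, foldr_boolPair_eq_encList]

/-- `encodingFinVec` spelled out: `⟨1ᵏ, ⟪e v₀, …, e v_{k-1}⟫⟩` (twin of `finVec_encode_eq` of
`Complexity/EncodingFrames.lean`, which states it in the `frames` form). [folklore] -/
theorem encodingFinVec_encode_eq {α : Type} (e : Encoding α Bool) {k : ℕ} (v : Fin k → α) :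
    (encodingFinVec e k).encode v = boolPair (ones k) (encList (List.ofFn fun i => e.encode (v i))) := by
  show e.listBool.encode (List.ofFn v) = _
  rw [listBool_encode_eq_encList, List.length_ofFn, List.map_ofFn]
  rfl

/-- **`encodeLWESamples` field by field**: `⟨bin n, ⟨bin q, ⟨1ᵐ, lweBlockCode S⟩⟩⟩`. Twin
(intended survivor: this one): `S2D.encodeLWESamples_eq` of `LWESearchToDecisionMachine.lean` (same
description with `S2D.sampleCode`). [cite: RegevLWE2009, §2] -/
theorem encodeLWESamples_eq (S : Fin m → (Fin n → ZMod q) × ZMod q) :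
    encodeLWESamples S = boolPair (encodeNat n) (boolPair (encodeNat q) (boolPair (ones m) (lweBlockCode S))) := by
  unfold encodeLWESamples
  rw [encodingFinVec_encode_eq]
  congr 3
  unfold lweBlockCode
  refine congrArg encList (congrArg List.ofFn (funext fun p => ?_))
  show boolPair ((encodingFinVec encodingNatBool n).encode fun i => ((S p).1 i).val) (encodeNat ((S p).2).val) = _
  rw [encodingFinVec_encode_eq]
  rfl

/-! ### Projections -/

/-- The unary dimension field of a sample code. [folklore] -/
@[simp] theorem fstF_fstF_lweSampleCode (x : (Fin n → ZMod q) × ZMod q) : fstF (fstF (lweSampleCode x)) = ones n := by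
  simp [lweSampleCode]

/-- The residue-vector field of a sample code. [folklore] -/
@[simp] theorem sndF_fstF_lweSampleCode (x : (Fin n → ZMod q) × ZMod q) : sndF (fstF (lweSampleCode x)) = lweResidueCode x.1 := by
  simp [lweSampleCode]

/-- The `b` field of a sample code. [folklore] -/
@[simp] theorem sndF_lweSampleCode (x : (Fin n → ZMod q) × ZMod q) : sndF (lweSampleCode x) = encodeNat x.2.val := by
  simp [lweSampleCode]

/-- The first residue of a residue code (positive dimension). [folklore] -/
theorem fstF_lweResidueCode (hn : 0 < n) (a : Fin n → ZMod q) : fstF (lweResidueCode a) = encodeNat (a ⟨0, hn⟩).val := by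
  obtain ⟨k, rfl⟩ : ∃ k, n = k + 1 := ⟨n - 1, by omega⟩
  rw [lweResidueCode, List.ofFn_succ, encList_cons, fstF_boolPair]
  rfl

/-- The residue code in dimension `0` is empty. [folklore] -/
theorem lweResidueCode_of_eq_zero (hn : n = 0) (a : Fin n → ZMod q) : lweResidueCode a = [] := by
  subst hn; rfl

/-- The fields of the code of a sample tuple. [folklore] -/
theorem fields_encodeLWESamples (S : Fin m → (Fin n → ZMod q) × ZMod q) :
    fstF (encodeLWESamples S) = encodeNat n ∧ nthF 1 (encodeLWESamples S) = encodeNat q ∧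
      nthF 2 (encodeLWESamples S) = ones m ∧ sndPow 2 (encodeLWESamples S) = lweBlockCode S := by
  rw [encodeLWESamples_eq]
  simp

/-- The first sample code of a nonempty block. [folklore] -/
theorem fstF_lweBlockCode (hm : 0 < m) (blk : Fin m → (Fin n → ZMod q) × ZMod q) :
    fstF (lweBlockCode blk) = lweSampleCode (blk ⟨0, hm⟩) := by
  obtain ⟨k, rfl⟩ : ∃ k, m = k + 1 := ⟨m - 1, by omega⟩
  rw [lweBlockCode, List.ofFn_succ, encList_cons, fstF_boolPair]
  rfl

/-! ### Length bounds -/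

section Lengths

variable [NeZero q]

/-- A representative has at most as many bits as the modulus. [folklore] -/
theorem length_encodeNat_val_le (v : ZMod q) : (encodeNat v.val).length ≤ (encodeNat q).length :=
  length_encodeNat_mono (ZMod.val_lt v).le

/-- Length of a residue code: `≤ n (2 |bin q| + 2)`. [folklore] -/
theorem length_lweResidueCode_le (a : Fin n → ZMod q) :
    (lweResidueCode a).length ≤ n * (2 * (encodeNat q).length + 2) := by
  rw [lweResidueCode, length_encList, List.map_ofFn, List.sum_ofFn]
  calc ∑ i : Fin n, (2 * (encodeNat (a i).val).length + 2) ≤ ∑ _i : Fin n, (2 * (encodeNat q).length + 2) :=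
        Finset.sum_le_sum fun i _ => by have := length_encodeNat_val_le (a i); omega
    _ = n * (2 * (encodeNat q).length + 2) := by simp

/-- The uniform bound on the length of a sample code: `8n + 6 + (4n + 1) |bin q|`. [folklore] -/
def sampleCodeBound (n q : ℕ) : ℕ := 8 * n + 6 + (4 * n + 1) * (encodeNat q).length

/-- Length of a sample code: `≤ sampleCodeBound n q`. [folklore] -/
theorem length_lweSampleCode_le (x : (Fin n → ZMod q) × ZMod q) : (lweSampleCode x).length ≤ sampleCodeBound n q := by
  rw [lweSampleCode, length_boolPair, length_boolPair, List.length_replicate, sampleCodeBound]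
  have h1 := length_lweResidueCode_le x.1
  have h2 := length_encodeNat_val_le x.2
  nlinarith [h1, h2, Nat.zero_le (encodeNat q).length]

/-- Length of a block code: `≤ m (2 · sampleCodeBound n q + 2)`. [folklore] -/
theorem length_lweBlockCode_le (blk : Fin m → (Fin n → ZMod q) × ZMod q) :
    (lweBlockCode blk).length ≤ m * (2 * sampleCodeBound n q + 2) := by
  rw [lweBlockCode, length_encList, List.map_ofFn, List.sum_ofFn]
  calc ∑ p : Fin m, (2 * (lweSampleCode (blk p)).length + 2) ≤ ∑ _p : Fin m, (2 * sampleCodeBound n q + 2) :=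
        Finset.sum_le_sum fun p _ => by have := length_lweSampleCode_le (blk p); omega
    _ = m * (2 * sampleCodeBound n q + 2) := by simp

/-- Length of the code of a sample tuple. [folklore] -/
theorem length_encodeLWESamples_le (S : Fin m → (Fin n → ZMod q) × ZMod q) :
    (encodeLWESamples S).length ≤
      2 * (encodeNat n).length + 2 + (2 * (encodeNat q).length + 2 + (2 * m + 2 + m * (2 * sampleCodeBound n q + 2))) := by
  rw [encodeLWESamples_eq, length_boolPair, length_boolPair, length_boolPair, List.length_replicate]
  have := length_lweBlockCode_le S
  omega

omit [NeZero q] in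
/-- Conversely the code of a NONEMPTY sample tuple is long: at least `n`, `|bin q|` and `m`. [folklore] -/
theorem le_length_encodeLWESamples (hm : 0 < m) (S : Fin m → (Fin n → ZMod q) × ZMod q) :
    n ≤ (encodeLWESamples S).length ∧ (encodeNat q).length ≤ (encodeLWESamples S).length ∧
      m ≤ (encodeLWESamples S).length := by
  rw [encodeLWESamples_eq, length_boolPair, length_boolPair, length_boolPair, List.length_replicate]
  have h1 : 2 * n ≤ (lweBlockCode S).length := by
    obtain ⟨k, rfl⟩ : ∃ k, m = k + 1 := ⟨m - 1, by omega⟩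
    rw [lweBlockCode, List.ofFn_succ, encList_cons, length_boolPair, lweSampleCode, length_boolPair, length_boolPair,
      List.length_replicate]
    omega
  omega

end Lengths

end LWE

end Literature.Computability.Cryptography

end
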